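import Summits.QuantumFields.YangMills.Theorems.BalabanUVNodesN27AtReadingOfRecord13CoPH
import Summits.QuantumFields.YangMills.Theorems.BalabanUVNodesSpineRatesHolder
import Summits.QuantumFields.YangMills.Theorems.BalabanUVNodesN16OfThm33LettersAllTorusAtRecord13CoPH
import Summits.QuantumFields.YangMills.Theorems.BalabanUVNodesN16AtRRec13CoPHLeafSlotAT

/-!
# BalabanUVNodes ∕ N27 = binder B5 AT THE RECORD — THE HOMES AND READING STOREYS AT NODE N16's CURRENCY OF RECORD «R-β» (plan g77 YMPLAN-G77-N16-PICK (B), I.23344; director-ym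
# №195 (4)): XXXIXᶜᵒᵖᴴ `…N27AtRecord13CoPHHomeOn` and XLᶜᵒᵖᴴ `…N27AtReadingOfRecord13CoPH` regime knits with node N16's stub read as dag-n16-c's `S_N16Holder β (RRec₁₃CoPHOn …)`
# ([Balaban1985RegularSpaces] (1.36) p. 82 «β ≦ β₀ < 1»; `N16HolderDefs` :219), K4's hook in dag-n16-e 41ᴴ's β-currency `RateInputsAllHolder … β` ∕ `SpineRates_of_forall_holder`
# (`…SpineRatesHolder` p573254), the N19′ edge reading `RatesHolderAt … β`; and the reading-level face with the N16 slot PRODUCED by dag-n16-e 40ᴮ §2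
# `exists_letters_s_N16Holder_readingOfRecord₁₃CoPHOn_of_thm33Letters_allTorus` (node N06's Theorem 3.3 + dag-n06-b's dictionary with the Hölder binder AT EXPONENT `β` + the [4]
# letters + N07's linear leaf; `0 ≤ β ≤ 1`) — the R-β twins of XXXIXᶜᵒᵖᴴ §5, XLᶜᵒᵖᴴ §2 and (L) §1
# (cell `pub-ymgap`, HUMAN RULING D-0062 Track A, R134 seat `pub-ymgap-dag-n27-c` (s2) gen 10; K3⁷ `SpineGivenEndpointR13SepCoPH` = stmt-QuantumFields-20544, `--kind proof --supports
# 20544 --as helper`; COUNT-NEUTRAL; THEOREMS ONLY, 0 `def`, 0 `sorry`; `N`-generic, regime-generic, NO Theses import — the item-facing face is leaf E `…N27SpineGivenEndpointR13SepCoPHHolder`)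

WHAT IS KERNEL-CHECKED ([bookkeeping]; proofs = the β = 1 storeys' proofs with the three holder names swapped in):
* §1 `coreEdge_of_homes₁₃CoPHOn_holder` · `spine_of_homes₁₃CoPHOn_holder` (any record class; XII `spine_of_coreEdge` at `(Rec, SRec₁₃CoPHOn cr Rg, RateInputsAllHolder (RRec₁₃CoPHOn 𝔯 Rg) β)`) ·
  ★ `spine_rec13CCoPHOn_of_homes₁₃CoPHOn_holder` (node00-def-RR-2's regime record class; `S_N27x` by XXXVIᶜᵒᵖᴴ `s_N27x_rec13CCoPHOn_of_keyed`).
* §2 ★ `spine_rec13CCoPHOn_at_readingOfRecord₁₃CoPH_holder` — the same at `𝔯 := readingOfRecord₁₃CoPH w1 ℓ₃ ne2 ne1`, N17 eliminated (dag-n17-a `s_N17_of_D4_N18`) ·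
  ★★ `spine_rec13CCoPHOn_at_readingOfRecord₁₃CoPH_holder_of_leafSlotHolderAT` — every rate slot in guarded θ-form, N16 at exponent β in the LIVE given-letters currency
  `InEndRegimeH ∧ LeafSlotHolderAT … β` (dag-n16-e 39ᴴ `s_N16Holder_readingOfRecord₁₃CoPHOn_of_leafSlotHolderAT`; (E) §1's R-β twin).
* §3 ★★ `spine_rec13CCoPHOn_at_readingOfRecord₁₃CoPH_holder_of_thm33Letters` — N16 at exponent β PRODUCED by 40ᴮ §2 from `hβ0 hβ1 hg₃ hD h7` (40ᴮ's binders VERBATIM as section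
  variables), the other rate slots in guarded θ-form, the N19′ edge reading `RatesHolderAt … β` for every `ℓ₃`.

HONEST FRAMING.  COMPOSITE-node bookkeeping BY NAME; every stub ∕ face ∕ edge ∕ letter is a HYPOTHESIS (0∕1 at the ₁₃ record today); β is a LETTER (the consumers' window
`2∕3 < β < 1` is theirs); NE3 at exponent β, NE7-cluster NOT PROVED; Thm 3.3 ∕ dictionary ∕ letters ∕ `LeafH3sup` are nodes N05∕N06∕N07's open obligations; nothing of Bałaban's
asserted or instantiated; no `Provisos₁₃CoPH` inhabitant claimed (K0⁷ open); the β = 1 storeys and every landed decl UNTOUCHED (additive file); N16 ∕ N27 NOT discharged; K3⁷ NOT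
claimed; counts UNMOVED (typed 28∕28 · discharged 5∕27, A 5∕28); one finite four-torus programme at fixed `ε` — NOT ℝ⁴, NOT infinite volume, NOT OS, NOT a mass gap, NOT Clay.
No decl below carries a cite tag.
-/

set_option autoImplicit false

namespace Summit.QuantumFields.YangMills.Theorems.BalabanUVNodesN27SpineRecord

open scoped Matrix.Norms.L2Operator

open Literature.MathematicalPhysics.QuantumFieldTheory.Balaban1983to89
open Literature.MathematicalPhysics.QuantumFieldTheory.Balaban1983to89.T4Continuum
open T4ContinuumYM4Torus (ForSmallCouplings)
open Summit.QuantumFields.BalabanUV.T4Continuum.Spine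
open YMDAG.UVSplit
open Node00 (Stage13HParams datumOfRecord₁₃CoPH IsRecordOfRecord₁₃CCoPH IsDatumOfRecord₁₃CCoPH NE3Letters₁₁ NE2Objects₁₁ ne3ConstLayerOfRecord₁₁ MatA)
open Node00.W1 (ReadingData)
open T4WeightBudget (RelWeightBound)
open T4IndicatorShell (ShellWeightBound)
open B7Prop1Explicit B7Prop2Explicit
open B8Ineq132 (InAk covDerivFwd)
open B8LeafModelZd (ZdIdx)
open B8SockLettersRD (SockLettersRD)
open B7Eq78Linearization (zdBlocking QprimeIter)
open B8Eq119TwistedAxial (bgT)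
open B8Eq140Level (SideTouches)
open B8Eq138LandauZd (covLap QT)
open B8Eq1117Concrete (XSpace)
open B8Prop5ContractionKLevel (Bd2)
open B8LambdaSpaceKLevel (wt)
open B9SupplySockB9P3ZdLetters (OpsZd)
open B9SupplySockB9P3ZdAt (DictAt Prop6At InvAt CurvAt LandauAt AvgAt HolderAt)
open Node00 (ne3NperOfRecord₁₁ ne3DomOfRecord₁₁)
open Summit.QuantumFields.BalabanUV.T4Continuum.NE3.LeafIndexSockets (LeafH3sup)
open Summit.QuantumFields.YangMills.BalabanUVNodes.N16HolderDefs (N16HolderAt S_N16Holder)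
open Summit.QuantumFields.YangMills.BalabanUVNodes.SpineRatesHolder (RatesHolderAt RateInputsAllHolder SpineRates_of_forall_holder)
open Summit.QuantumFields.YangMills.BalabanUVNodes.N16OfThm33LettersAllTorusAtRecord13CoPH (exists_letters_s_N16Holder_readingOfRecord₁₃CoPHOn_of_thm33Letters_allTorus)
open Summit.QuantumFields.YangMills.BalabanUVNodes.N16HolderRegime (InEndRegimeH)
open Summit.QuantumFields.YangMills.BalabanUVNodes.N16LeafSlotAllTorus (LeafSlotHolderAT)
open Summit.QuantumFields.YangMills.BalabanUVNodes.N16AtRRec13CoPHLeafSlotAT (s_N16Holder_readingOfRecord₁₃CoPHOn_of_leafSlotHolderAT)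

variable {N : ℕ} [NeZero N] (cr : SpineReading₁₃CoPH N) (β : ℝ)

/-! ## §1 The regime-restricted Stage-13 `CoPH` carrier homes at exponent `β` (XXXIXᶜᵒᵖᴴ §1∕§2∕§5 twins; n16-e 41ᴴ `RateInputsAllHolder`, `SpineRates_of_forall_holder`) -/

section Homes

variable (𝔯 : RateReading₁₃CoPH N) (Rg : (F : T4Family) → Stage13HParams F N → Prop)

/-- **THE SAME-TUPLE EDGE AT THE REGIME HOMES, β-RATES** (XXXIXᶜᵒᵖᴴ `coreEdge_of_homes₁₃CoPHOn` with `RateInputsAll ↦ RateInputsAllHolder … β`, `RatesAt ↦ RatesHolderAt … β`): the guarded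
θ-keyed all-run-lengths N19′ edge at exponent `β` gives XII's edge at `(SRec₁₃CoPHOn cr Rg, RateInputsAllHolder (RRec₁₃CoPHOn 𝔯 Rg) β)` (`rRec₁₃CoPHOn_self`). [bookkeeping] -/
theorem coreEdge_of_homes₁₃CoPHOn_holder
    (h19 : ∀ (F : T4Family) (θ : Stage13HParams F N) (hP : θ.Provisos₁₃CoPH F N), Rg F θ → θ.Admissible F N → ∀ (g₀ : ℕ → ℝ) (os : List (ULoop F)),
      (∀ k : ℕ, RatesHolderAt (datumOfRecord₁₃CoPH F N θ hP) (rateCarriersOfRecord₁₃CoPH 𝔯 F θ hP g₀ os k) β) → letI := (cr F θ hP g₀ os).dec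
        ∃ δ : ℕ → ℝ, NE7.Core (cr F θ hP g₀ os).l₀ (cr F θ hP g₀ os).vol (cr F θ hP g₀ os).T (cr F θ hP g₀ os).Bad
          (fun K t τ => (cr F θ hP g₀ os).A K t τ - (cr F θ hP g₀ os).shA K t τ) (fun K t τ => (cr F θ hP g₀ os).B K t τ - (cr F θ hP g₀ os).shB K t τ) δ ∧
          Summable δ)
    (F : T4Family) (D : Datum F N) (g₀ : ℕ → ℝ) (os : List (ULoop F)) (S : SpineCarriers) (hS : SRec₁₃CoPHOn cr Rg F D g₀ os S)
    (hin : RateInputsAllHolder (RRec₁₃CoPHOn 𝔯 Rg) β F D g₀ os) :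
    letI := S.dec
      ∃ δ : ℕ → ℝ, NE7.Core S.l₀ S.vol S.T S.Bad (fun K t τ => S.A K t τ - S.shA K t τ) (fun K t τ => S.B K t τ - S.shB K t τ) δ ∧ Summable δ := by
  obtain ⟨θ, hP, hRg, hθ, rfl, rfl⟩ := hS
  exact h19 F θ hP hRg hθ g₀ os fun k => hin _ (rRec₁₃CoPHOn_self 𝔯 Rg θ hP hRg hθ g₀ os k)

/-- **N27 = B5 AT ANY RECORD CLASS FROM THE STUB INSTANCES OF THE TWO REGIME HOMES AT EXPONENT `β`** (XXXIXᶜᵒᵖᴴ `spine_of_homes₁₃CoPHOn` with `h16 : S_N16Holder β …`; XII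
`spine_of_coreEdge` at `(Rec, SRec₁₃CoPHOn cr Rg, RateInputsAllHolder (RRec₁₃CoPHOn 𝔯 Rg) β)`, K4's ∀-hook by 41ᴴ `SpineRates_of_forall_holder`).  Every stub a HYPOTHESIS. [bookkeeping] -/
theorem spine_of_homes₁₃CoPHOn_holder (Rec : RecordPred N)
    (h14 : S_N14 (RRec₁₃CoPHOn 𝔯 Rg)) (h15 : S_N15 (RRec₁₃CoPHOn 𝔯 Rg))
    (h16 : S_N16Holder β (RRec₁₃CoPHOn 𝔯 Rg)) (h17 : S_N17 (RRec₁₃CoPHOn 𝔯 Rg))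
    (h18 : S_N18 (RRec₁₃CoPHOn 𝔯 Rg)) (h22 : S_N22 (RRec₁₃CoPHOn 𝔯 Rg))
    (hx' : S_N27x Rec (SRec₁₃CoPHOn cr Rg)) (h20 : S_N20 (SRec₁₃CoPHOn cr Rg)) (h21 : S_N21 (SRec₁₃CoPHOn cr Rg))
    (h19 : ∀ (F : T4Family) (θ : Stage13HParams F N) (hP : θ.Provisos₁₃CoPH F N), Rg F θ → θ.Admissible F N → ∀ (g₀ : ℕ → ℝ) (os : List (ULoop F)),
      (∀ k : ℕ, RatesHolderAt (datumOfRecord₁₃CoPH F N θ hP) (rateCarriersOfRecord₁₃CoPH 𝔯 F θ hP g₀ os k) β) → letI := (cr F θ hP g₀ os).dec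
        ∃ δ : ℕ → ℝ, NE7.Core (cr F θ hP g₀ os).l₀ (cr F θ hP g₀ os).vol (cr F θ hP g₀ os).T (cr F θ hP g₀ os).Bad
          (fun K t τ => (cr F θ hP g₀ os).A K t τ - (cr F θ hP g₀ os).shA K t τ) (fun K t τ => (cr F θ hP g₀ os).B K t τ - (cr F θ hP g₀ os).shB K t τ) δ ∧
          Summable δ) :
    Spine Rec :=
  spine_of_coreEdge Rec (SRec₁₃CoPHOn cr Rg) (RateInputsAllHolder (RRec₁₃CoPHOn 𝔯 Rg) β) hx' h20 h21 (coreEdge_of_homes₁₃CoPHOn_holder cr β 𝔯 Rg h19)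
    (SpineRates_of_forall_holder Rec (RRec₁₃CoPHOn 𝔯 Rg) h14 h15 h16 h17 h18 h22)

/-- ★ **N27 = B5 AT node00-def-RR-2's REGIME RECORD CLASS FROM THE STUBS AT THE REGIME HOMES AT EXPONENT `β`** (XXXIXᶜᵒᵖᴴ `spine_rec13CCoPHOn_of_homes₁₃CoPHOn` with `h16 : S_N16Holder β
(RRec₁₃CoPHOn 𝔯 Rg)` — node N16's stub IN THE CURRENCY OF RECORD R-β — and the N19′ edge reading `RatesHolderAt … β`; `S_N27x` by XXXVIᶜᵒᵖᴴ `s_N27x_rec13CCoPHOn_of_keyed`).  At `N = 2`,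
`Rg := Node00.unityNondeg₁₃H 2` leaf A §4's one-way door `spineGivenEndpointR13SepCoPH_of_spine_rec13CCoPHOn` gives THE ITEM — packaged at exponent `β` as the item-facing leaf E
`…N27SpineGivenEndpointR13SepCoPHHolder` (v1.0.1: wording of dag-ref-D READ #335 NIT-1).  Every hypothesis 0∕1 today; NE3 at exponent β NOT PROVED. [bookkeeping] -/
theorem spine_rec13CCoPHOn_of_homes₁₃CoPHOn_holder
    (h14 : S_N14 (RRec₁₃CoPHOn 𝔯 Rg)) (h15 : S_N15 (RRec₁₃CoPHOn 𝔯 Rg))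
    (h16 : S_N16Holder β (RRec₁₃CoPHOn 𝔯 Rg)) (h17 : S_N17 (RRec₁₃CoPHOn 𝔯 Rg))
    (h18 : S_N18 (RRec₁₃CoPHOn 𝔯 Rg)) (h22 : S_N22 (RRec₁₃CoPHOn 𝔯 Rg))
    (h20 : S_N20 (SRec₁₃CoPHOn cr Rg)) (h21 : S_N21 (SRec₁₃CoPHOn cr Rg))
    (hx : ∀ (F : T4Family) (θ : Stage13HParams F N) (hP : θ.Provisos₁₃CoPH F N), Rg F θ → θ.Admissible F N →
      B16.EndStatementBPrinted (datumOfRecord₁₃CoPH F N θ hP).C → DagBinding.EndpointExistence (datumOfRecord₁₃CoPH F N θ hP).C.toB12 →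
        ForSmallCouplings (datumOfRecord₁₃CoPH F N θ hP) fun g₀ => ∀ os : List (ULoop F),
          0 < (cr F θ hP g₀ os).l₀ ∧ 0 < (cr F θ hP g₀ os).vol ∧
          (∀ (K : ℕ) (t : ℝ), |t| ≤ (cr F θ hP g₀ os).l₀ →
            T4GenFunBounds.schemeZ ((datumOfRecord₁₃CoPH F N θ hP).scheme g₀) os ((cr F θ hP g₀ os).K₀ + K) t =
              ∑ τ ∈ (cr F θ hP g₀ os).T K, (cr F θ hP g₀ os).A K t τ) ∧
          (∀ (K : ℕ) (t : ℝ), |t| ≤ (cr F θ hP g₀ os).l₀ →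
            T4GenFunBounds.schemeZ ((datumOfRecord₁₃CoPH F N θ hP).scheme g₀) os ((cr F θ hP g₀ os).K₀ + K + 1) t =
              ∑ τ ∈ (cr F θ hP g₀ os).T K, (cr F θ hP g₀ os).B K t τ))
    (h19 : ∀ (F : T4Family) (θ : Stage13HParams F N) (hP : θ.Provisos₁₃CoPH F N), Rg F θ → θ.Admissible F N → ∀ (g₀ : ℕ → ℝ) (os : List (ULoop F)),
      (∀ k : ℕ, RatesHolderAt (datumOfRecord₁₃CoPH F N θ hP) (rateCarriersOfRecord₁₃CoPH 𝔯 F θ hP g₀ os k) β) → letI := (cr F θ hP g₀ os).dec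
        ∃ δ : ℕ → ℝ, NE7.Core (cr F θ hP g₀ os).l₀ (cr F θ hP g₀ os).vol (cr F θ hP g₀ os).T (cr F θ hP g₀ os).Bad
          (fun K t τ => (cr F θ hP g₀ os).A K t τ - (cr F θ hP g₀ os).shA K t τ) (fun K t τ => (cr F θ hP g₀ os).B K t τ - (cr F θ hP g₀ os).shB K t τ) δ ∧
          Summable δ) :
    Spine (N := N) fun F D w => Node00.IsRecordOfRecord₁₃CCoPHOn F N Rg D w :=
  spine_of_homes₁₃CoPHOn_holder cr β 𝔯 Rg _ h14 h15 h16 h17 h18 h22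
    (s_N27x_rec13CCoPHOn_of_keyed Rg cr (SRec₁₃CoPHOn cr Rg) (fun _ D g₀ os S => sRec₁₃CoPHOn_iff_bundled cr Rg D g₀ os S) hx) h20 h21 h19

end Homes

/-! ## §2 dag-n22-e's Stage-13 `CoPH` rate READING of record at exponent `β` (XLᶜᵒᵖᴴ regime twins), and the N16 slot read off node N06's Theorem 3.3 at exponent `β` -/

section Reading

variable (w1 : (F : T4Family) → (θ : Stage13HParams F N) → Node00.W1.ReadingData F (Node00.MatA N) θ.τ9.M)
  (ne2 : (F : T4Family) → Stage13HParams F N → (ℕ → ℝ) → List (ULoop F) → ℕ → NE2Objects₁₁)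
  (ne1 : (F : T4Family) → Stage13HParams F N → (ℕ → ℝ) → List (ULoop F) → NE1pCarriers)
variable (Rg : (F : T4Family) → Stage13HParams F N → Prop)

/-- ★ **N27 = B5 AT THE REGIME RECORD CLASS FROM THE STUBS AT THE REGIME HOME OF THE READING OF RECORD, N16 IN THE CURRENCY OF RECORD R-β, N17 ELIMINATED** (XLᶜᵒᵖᴴ
`spine_rec13CCoPHOn_at_readingOfRecord₁₃CoPH` with `h16 : S_N16Holder β (RRec₁₃CoPHOn (readingOfRecord₁₃CoPH w1 ℓ₃ ne2 ne1) Rg)` and `h19` reading `RatesHolderAt … β`; N17 by dag-n17-a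
`s_N17_of_D4_N18`).  Every hypothesis 0∕1 today. [bookkeeping] -/
theorem spine_rec13CCoPHOn_at_readingOfRecord₁₃CoPH_holder (ℓ₃ : T4Family → NE3Letters₁₁)
    (h14 : S_N14 (RRec₁₃CoPHOn (readingOfRecord₁₃CoPH w1 ℓ₃ ne2 ne1) Rg)) (h15 : S_N15 (RRec₁₃CoPHOn (readingOfRecord₁₃CoPH w1 ℓ₃ ne2 ne1) Rg))
    (h16 : S_N16Holder β (RRec₁₃CoPHOn (readingOfRecord₁₃CoPH w1 ℓ₃ ne2 ne1) Rg)) (h18 : S_N18 (RRec₁₃CoPHOn (readingOfRecord₁₃CoPH w1 ℓ₃ ne2 ne1) Rg))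
    (h22 : S_N22 (RRec₁₃CoPHOn (readingOfRecord₁₃CoPH w1 ℓ₃ ne2 ne1) Rg)) (hD4 : S_D4 (RRec₁₃CoPHOn (readingOfRecord₁₃CoPH w1 ℓ₃ ne2 ne1) Rg))
    (h20 : S_N20 (SRec₁₃CoPHOn cr Rg)) (h21 : S_N21 (SRec₁₃CoPHOn cr Rg))
    (hx : ∀ (F : T4Family) (θ : Stage13HParams F N) (hP : θ.Provisos₁₃CoPH F N), Rg F θ → θ.Admissible F N →
      B16.EndStatementBPrinted (datumOfRecord₁₃CoPH F N θ hP).C → DagBinding.EndpointExistence (datumOfRecord₁₃CoPH F N θ hP).C.toB12 →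
        ForSmallCouplings (datumOfRecord₁₃CoPH F N θ hP) fun g₀ => ∀ os : List (ULoop F),
          0 < (cr F θ hP g₀ os).l₀ ∧ 0 < (cr F θ hP g₀ os).vol ∧
          (∀ (K : ℕ) (t : ℝ), |t| ≤ (cr F θ hP g₀ os).l₀ →
            T4GenFunBounds.schemeZ ((datumOfRecord₁₃CoPH F N θ hP).scheme g₀) os ((cr F θ hP g₀ os).K₀ + K) t =
              ∑ τ ∈ (cr F θ hP g₀ os).T K, (cr F θ hP g₀ os).A K t τ) ∧
          (∀ (K : ℕ) (t : ℝ), |t| ≤ (cr F θ hP g₀ os).l₀ →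
            T4GenFunBounds.schemeZ ((datumOfRecord₁₃CoPH F N θ hP).scheme g₀) os ((cr F θ hP g₀ os).K₀ + K + 1) t =
              ∑ τ ∈ (cr F θ hP g₀ os).T K, (cr F θ hP g₀ os).B K t τ))
    (h19 : ∀ (F : T4Family) (θ : Stage13HParams F N) (hP : θ.Provisos₁₃CoPH F N), Rg F θ → θ.Admissible F N → ∀ (g₀ : ℕ → ℝ) (os : List (ULoop F)),
      (∀ k : ℕ, RatesHolderAt (datumOfRecord₁₃CoPH F N θ hP) (rateCarriersOfRecord₁₃CoPH (readingOfRecord₁₃CoPH w1 ℓ₃ ne2 ne1) F θ hP g₀ os k) β) → letI := (cr F θ hP g₀ os).dec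
        ∃ δ : ℕ → ℝ, NE7.Core (cr F θ hP g₀ os).l₀ (cr F θ hP g₀ os).vol (cr F θ hP g₀ os).T (cr F θ hP g₀ os).Bad
          (fun K t τ => (cr F θ hP g₀ os).A K t τ - (cr F θ hP g₀ os).shA K t τ) (fun K t τ => (cr F θ hP g₀ os).B K t τ - (cr F θ hP g₀ os).shB K t τ) δ ∧
          Summable δ) :
    Spine (N := N) fun F D w => Node00.IsRecordOfRecord₁₃CCoPHOn F N Rg D w :=
  spine_rec13CCoPHOn_of_homes₁₃CoPHOn_holder cr β _ Rg h14 h15 h16 (YMDAG.N17.s_N17_of_D4_N18 _ hD4 h18) h18 h22 h20 h21 hx h19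

/-- ★★ **THE SAME WITH EVERY RATE SLOT IN GUARDED θ-FORM AND N16 AT EXPONENT `β` IN THE LIVE GIVEN-LETTERS CURRENCY `InEndRegimeH ∧ LeafSlotHolderAT … β`** ((E) §1 regime's R-β
twin; `h16` closed by dag-n16-e 39ᴴ `s_N16Holder_readingOfRecord₁₃CoPHOn_of_leafSlotHolderAT hβ0 hβ1` — exactly what 37ᴴ ∕ 38ᴴ ∕ 40ᴮ §2 deliver per family at the letters they choose;
`0 ≤ β ≤ 1`).  Every hypothesis 0∕1 today; NE3 at exponent β NOT PROVED. [bookkeeping] -/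
theorem spine_rec13CCoPHOn_at_readingOfRecord₁₃CoPH_holder_of_leafSlotHolderAT (hβ0 : 0 ≤ β) (hβ1 : β ≤ 1) (ℓ₃ : T4Family → NE3Letters₁₁)
    (h14 : ∀ (F : T4Family) (θ : Stage13HParams F N), θ.Provisos₁₃CoPH F N → Rg F θ → θ.Admissible F N → ∀ (g₀ : ℕ → ℝ) (os : List (ULoop F)),
      N14At (ne1 F θ g₀ os))
    (h15 : ∀ (F : T4Family) (θ : Stage13HParams F N), θ.Provisos₁₃CoPH F N → Rg F θ → θ.Admissible F N → ∀ (g₀ : ℕ → ℝ) (os : List (ULoop F)) (k : ℕ),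
      N15At (ne2OfRecord₁₁ (ne2 F θ g₀ os k)))
    (h16 : ∀ (F : T4Family), (∃ θ : Stage13HParams F N, θ.Provisos₁₃CoPH F N ∧ Rg F θ ∧ θ.Admissible F N) →
      InEndRegimeH (ne3OfRecord₁₁ F (ne3ConstLayerOfRecord₁₁ F N (ℓ₃ F))) ∧ LeafSlotHolderAT (ne3OfRecord₁₁ F (ne3ConstLayerOfRecord₁₁ F N (ℓ₃ F))) β)
    (h18 : ∀ (F : T4Family) (θ : Stage13HParams F N), θ.Provisos₁₃CoPH F N → Rg F θ → θ.Admissible F N → ∀ k : ℕ,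
      N18At (u3OfRecord₁₃ θ.toStage13Params ((w1 F θ).u3Objects θ.γ) k))
    (h22 : ∀ (F : T4Family) (θ : Stage13HParams F N), θ.Provisos₁₃CoPH F N → Rg F θ → θ.Admissible F N → ∀ k : ℕ,
      N22At (u3OfRecord₁₃ θ.toStage13Params ((w1 F θ).u3Objects θ.γ) k))
    (hD4 : ∀ (F : T4Family) (θ : Stage13HParams F N) (hP : θ.Provisos₁₃CoPH F N), Rg F θ → θ.Admissible F N → ∀ k : ℕ,
      ReadOutAt (datumOfRecord₁₃CoPH F N θ hP) (u3OfRecord₁₃ θ.toStage13Params ((w1 F θ).u3Objects θ.γ) k))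
    (h20 : S_N20 (SRec₁₃CoPHOn cr Rg)) (h21 : S_N21 (SRec₁₃CoPHOn cr Rg))
    (hx : ∀ (F : T4Family) (θ : Stage13HParams F N) (hP : θ.Provisos₁₃CoPH F N), Rg F θ → θ.Admissible F N →
      B16.EndStatementBPrinted (datumOfRecord₁₃CoPH F N θ hP).C → DagBinding.EndpointExistence (datumOfRecord₁₃CoPH F N θ hP).C.toB12 →
        ForSmallCouplings (datumOfRecord₁₃CoPH F N θ hP) fun g₀ => ∀ os : List (ULoop F),
          0 < (cr F θ hP g₀ os).l₀ ∧ 0 < (cr F θ hP g₀ os).vol ∧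
          (∀ (K : ℕ) (t : ℝ), |t| ≤ (cr F θ hP g₀ os).l₀ →
            T4GenFunBounds.schemeZ ((datumOfRecord₁₃CoPH F N θ hP).scheme g₀) os ((cr F θ hP g₀ os).K₀ + K) t =
              ∑ τ ∈ (cr F θ hP g₀ os).T K, (cr F θ hP g₀ os).A K t τ) ∧
          (∀ (K : ℕ) (t : ℝ), |t| ≤ (cr F θ hP g₀ os).l₀ →
            T4GenFunBounds.schemeZ ((datumOfRecord₁₃CoPH F N θ hP).scheme g₀) os ((cr F θ hP g₀ os).K₀ + K + 1) t =
              ∑ τ ∈ (cr F θ hP g₀ os).T K, (cr F θ hP g₀ os).B K t τ))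
    (h19 : ∀ (F : T4Family) (θ : Stage13HParams F N) (hP : θ.Provisos₁₃CoPH F N), Rg F θ → θ.Admissible F N → ∀ (g₀ : ℕ → ℝ) (os : List (ULoop F)),
      (∀ k : ℕ, RatesHolderAt (datumOfRecord₁₃CoPH F N θ hP) (rateCarriersOfRecord₁₃CoPH (readingOfRecord₁₃CoPH w1 ℓ₃ ne2 ne1) F θ hP g₀ os k) β) → letI := (cr F θ hP g₀ os).dec
        ∃ δ : ℕ → ℝ, NE7.Core (cr F θ hP g₀ os).l₀ (cr F θ hP g₀ os).vol (cr F θ hP g₀ os).T (cr F θ hP g₀ os).Bad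
          (fun K t τ => (cr F θ hP g₀ os).A K t τ - (cr F θ hP g₀ os).shA K t τ) (fun K t τ => (cr F θ hP g₀ os).B K t τ - (cr F θ hP g₀ os).shB K t τ) δ ∧
          Summable δ) :
    Spine (N := N) fun F D w => Node00.IsRecordOfRecord₁₃CCoPHOn F N Rg D w :=
  spine_rec13CCoPHOn_at_readingOfRecord₁₃CoPH_holder cr β w1 ne2 ne1 Rg ℓ₃
    ((s_N14_rRec₁₃CoPHOn_iff _ Rg).mpr fun F θ hP hRg hθ g₀ os => h14 F θ hP hRg hθ g₀ os)
    ((s_N15_rRec₁₃CoPHOn_iff _ Rg).mpr fun F θ hP hRg hθ g₀ os k => h15 F θ hP hRg hθ g₀ os k)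
    (s_N16Holder_readingOfRecord₁₃CoPHOn_of_leafSlotHolderAT (Rg := Rg) (w1 := w1) (ℓ₃ := ℓ₃) (ne2 := ne2) (ne1 := ne1) hβ0 hβ1 h16)
    ((s_N18_rRec₁₃CoPHOn_iff _ Rg).mpr fun F θ hP hRg hθ _ _ k => h18 F θ hP hRg hθ k)
    ((s_N22_rRec₁₃CoPHOn_iff _ Rg).mpr fun F θ hP hRg hθ _ _ k => h22 F θ hP hRg hθ k)
    ((s_D4_rRec₁₃CoPHOn_iff _ Rg).mpr fun F θ hP hRg hθ _ _ k => hD4 F θ hP hRg hθ k) h20 h21 hx h19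

end Reading

/-! ## §3 The N16 slot AT EXPONENT `β` read off node N06's Theorem 3.3 + dictionary AT EXPONENT `β` + letters + N07's leaf (dag-n16-e 40ᴮ §2, letters produced; `0 ≤ β ≤ 1`) -/

section Thm33

variable {β}
variable (hβ0 : 0 ≤ β) (hβ1 : β ≤ 1)
variable {g₃ : T4Family → ℝ} (hg₃ : ∀ F, 0 < g₃ F)
  (hD : ∀ F : T4Family, letI : CStarAlgebra (Matrix (Fin N) (Fin N) ℂ) := {}
      ∃ (len : Site 4 → ℝ) (I : Type) (geo : I → B9.Geometry) (bg : I → B9.Backgrounds) (GA Gp : ∀ i, B9.KernelFamily (geo i) (bg i)) (c35 : ℝ)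
        (mem : ℝ → ZdIdx 4 F.L → ℕ → I)
        (ιCfg : ∀ (M : ℝ) (i : ZdIdx 4 F.L) (m : ℕ) (U₀ : Site 4 → Fin 4 → (Matrix (Fin N) (Fin N) ℂ)ˣ), (∀ x κ, U₀ x κ ∈ unitaryUnits (Matrix (Fin N) (Fin N) ℂ)) → (bg (mem M i m)).Cfg)
        (ιLoc : ∀ (M : ℝ) (i : ZdIdx 4 F.L) (m : ℕ), (Site 4 → Fin 4 → Matrix (Fin N) (Fin N) ℂ) → (geo (mem M i m)).Loc)
        (ops : ℝ → ZdIdx 4 F.L → ℕ → OpsZd 4 (Matrix (Fin N) (Fin N) ℂ)) (c₆ K₆ M₃ a₃ c69 q CH B₀'H B₂' BG BR cL : ℝ),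
        (∀ v : Site 4, 0 < len v → 1 ≤ len v) ∧ (∀ μ : Fin 4, len (e μ) = 1) ∧
        B9.Thm33Printed c35 geo bg Gp GA ∧
        0 < c₆ ∧ 0 < K₆ ∧ 0 < a₃ ∧ 0 ≤ c69 ∧ 0 ≤ q ∧ 0 < B₀'H ∧ 0 ≤ B₂' ∧ 0 ≤ BG ∧ 0 ≤ BR ∧ 0 < cL ∧
        (∀ (M : ℝ) (i : {i : ZdIdx 4 F.L // (∀ j, i.Ω j = Set.univ) ∧ (∀ m j, i.Λs m j = {_y | j = m}) ∧ (∀ m j, i.Λb m j = {_c | j = m}) ∧ i.η = ((F.L : ℝ)⁻¹) ^ i.k}) (m : ℕ), DictAt geo bg GA F.L mem ιCfg ιLoc ops M i.1 m) ∧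
        (∀ (M : ℝ) (i : {i : ZdIdx 4 F.L // (∀ j, i.Ω j = Set.univ) ∧ (∀ m j, i.Λs m j = {_y | j = m}) ∧ (∀ m j, i.Λb m j = {_c | j = m}) ∧ i.η = ((F.L : ℝ)⁻¹) ^ i.k}) (m : ℕ), M₃ ≤ M → Prop6At bg F.L mem ιCfg c35 c₆ K₆ M i.1 m) ∧
        (∀ (M : ℝ) (i : {i : ZdIdx 4 F.L // (∀ j, i.Ω j = Set.univ) ∧ (∀ m j, i.Λs m j = {_y | j = m}) ∧ (∀ m j, i.Λb m j = {_c | j = m}) ∧ i.η = ((F.L : ℝ)⁻¹) ^ i.k}) (m : ℕ), M₃ ≤ M → InvAt bg F.L mem ιCfg ops c35 a₃ M i.1 m) ∧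
        (∀ (M : ℝ) (i : {i : ZdIdx 4 F.L // (∀ j, i.Ω j = Set.univ) ∧ (∀ m j, i.Λs m j = {_y | j = m}) ∧ (∀ m j, i.Λb m j = {_c | j = m}) ∧ i.η = ((F.L : ℝ)⁻¹) ^ i.k}) (m : ℕ), M₃ ≤ M → CurvAt bg F.L mem ιCfg ops c35 a₃ c69 M i.1 m) ∧
        (∀ (M : ℝ) (i : {i : ZdIdx 4 F.L // (∀ j, i.Ω j = Set.univ) ∧ (∀ m j, i.Λs m j = {_y | j = m}) ∧ (∀ m j, i.Λb m j = {_c | j = m}) ∧ i.η = ((F.L : ℝ)⁻¹) ^ i.k}) (m : ℕ), M₃ ≤ M → LandauAt bg F.L mem ιCfg ops c35 a₃ M i.1 m) ∧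
        (∀ (M : ℝ) (i : {i : ZdIdx 4 F.L // (∀ j, i.Ω j = Set.univ) ∧ (∀ m j, i.Λs m j = {_y | j = m}) ∧ (∀ m j, i.Λb m j = {_c | j = m}) ∧ i.η = ((F.L : ℝ)⁻¹) ^ i.k}) (m : ℕ), AvgAt F.L ops q M i.1 m) ∧
        (∀ (M : ℝ) (i : {i : ZdIdx 4 F.L // (∀ j, i.Ω j = Set.univ) ∧ (∀ m j, i.Λs m j = {_y | j = m}) ∧ (∀ m j, i.Λb m j = {_c | j = m}) ∧ i.η = ((F.L : ℝ)⁻¹) ^ i.k}) (m : ℕ), HolderAt geo bg GA F.L mem ιCfg ops β len CH M i.1 m) ∧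
        (∀ i : {i : ZdIdx 4 F.L // (∀ j, i.Ω j = Set.univ) ∧ (∀ m j, i.Λs m j = {_y | j = m}) ∧ (∀ m j, i.Λb m j = {_c | j = m}) ∧ i.η = ((F.L : ℝ)⁻¹) ^ i.k}, SockLettersRD (𝔸 := Matrix (Fin N) (Fin N) ℂ) F.L BG BR B₀'H B₂' cL i.1.η i.1.k i.1.Ω i.1.Λs) ∧
        (∀ i : {i : ZdIdx 4 F.L // (∀ j, i.Ω j = Set.univ) ∧ (∀ m j, i.Λs m j = {_y | j = m}) ∧ (∀ m j, i.Λb m j = {_c | j = m}) ∧ i.η = ((F.L : ℝ)⁻¹) ^ i.k}, ∀ α₀ : ℝ, 0 < α₀ → α₀ ≤ cL → ∀ U₀ : Site 4 → Fin 4 → (Matrix (Fin N) (Fin N) ℂ)ˣ, (∀ x κ, U₀ x κ ∈ unitaryUnits (Matrix (Fin N) (Fin N) ℂ)) →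
          InAk F.L i.1.k i.1.η α₀ i.1.Ω U₀ →
          ∃ (g Δ : (Site 4 → Matrix (Fin N) (Fin N) ℂ) →ₗ[ℂ] (Site 4 → Matrix (Fin N) (Fin N) ℂ)) (q : (Site 4 → Matrix (Fin N) (Fin N) ℂ) →ₗ[ℂ] (ℕ → Site 4 → Matrix (Fin N) (Fin N) ℂ))
            (qs : (ℕ → Site 4 → Matrix (Fin N) (Fin N) ℂ) →ₗ[ℂ] (Site 4 → Matrix (Fin N) (Fin N) ℂ)) (Aw c : (ℕ → Site 4 → Matrix (Fin N) (Fin N) ℂ) →ₗ[ℂ] (ℕ → Site 4 → Matrix (Fin N) (Fin N) ℂ))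
            (H' : XSpace 4 i.1.k (Matrix (Fin N) (Fin N) ℂ) →ₗ[ℂ] (Site 4 → Matrix (Fin N) (Fin N) ℂ)),
            (∀ x : Site 4 → Matrix (Fin N) (Fin N) ℂ, (∃ C : ℝ, ∀ y, ‖x y‖ ≤ C) → g (Δ x + qs (Aw (q x))) = x) ∧ (∀ φ, qs (c (q (g (g (qs φ))))) = qs φ) ∧
            (∀ (f : Site 4 → Matrix (Fin N) (Fin N) ℂ), ∀ x ∈ i.1.Ω 0, Δ f x = covLap i.1.η U₀ ((i.1.Ω 0).indicator f) x) ∧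
            (∀ (μ : ℕ → Site 4 → Matrix (Fin N) (Fin N) ℂ), ∀ x ∈ i.1.Ω 0, qs μ x = QT F.L i.1.k (i.1.Λs i.1.k) U₀ μ x) ∧
            (∀ (f : Site 4 → Matrix (Fin N) (Fin N) ℂ) (n : ℕ), n ≤ i.1.k → ∀ y ∈ i.1.Λs i.1.k n, q f n y = QprimeIter (zdBlocking 4 F.L) (bgT F.L U₀) n f y) ∧
            (∀ (f : Site 4 → Matrix (Fin N) (Fin N) ℂ) (n : ℕ) (y : Site 4), ¬ (n ≤ i.1.k ∧ y ∈ i.1.Λs i.1.k n) → q f n y = 0) ∧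
            (∀ (X : XSpace 4 i.1.k (Matrix (Fin N) (Fin N) ℂ)) (x : Site 4), ‖H' X x‖ ≤ B₀'H * ‖X‖) ∧
            (∀ n, n ≤ i.1.k → ∀ (X : XSpace 4 i.1.k (Matrix (Fin N) (Fin N) ℂ)), ∀ p ∈ {b : Site 4 × Fin 4 | SideTouches (i.1.Ω n) b.1 b.2},
              wt F.L i.1.η n * ‖covDerivFwd i.1.η U₀ p.2 (H' X) p.1‖ ≤ B₀'H * ‖X‖) ∧
            (∀ X : XSpace 4 i.1.k (Matrix (Fin N) (Fin N) ℂ), Bd2 F.L i.1.η i.1.k i.1.Ω (covLap i.1.η U₀ (H' X)) (B₂' * ‖X‖)) ∧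
            (∀ (Y : XSpace 4 i.1.k (Matrix (Fin N) (Fin N) ℂ)) (n : ℕ) (hn : n ≤ i.1.k) (y : Site 4), y ∈ i.1.Λs i.1.k n →
              QprimeIter (zdBlocking 4 F.L) (bgT F.L U₀) n (H' Y) y = Y (⟨n, Nat.lt_succ_of_le hn⟩, y)) ∧
            (∀ (f : Site 4 → Matrix (Fin N) (Fin N) ℂ) (r : ℝ), 0 ≤ r → Bd2 F.L i.1.η i.1.k i.1.Ω f r →
              (∀ x, ‖g f x‖ ≤ BG * r) ∧ ∀ n, n ≤ i.1.k → ∀ p ∈ {b : Site 4 × Fin 4 | SideTouches (i.1.Ω n) b.1 b.2},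
                wt F.L i.1.η n * ‖covDerivFwd i.1.η U₀ p.2 (g f) p.1‖ ≤ BG * r) ∧
            (∀ (f : Site 4 → Matrix (Fin N) (Fin N) ℂ) (r : ℝ), 0 ≤ r → Bd2 F.L i.1.η i.1.k i.1.Ω f r → Bd2 F.L i.1.η i.1.k i.1.Ω (f - g (qs (c (q (g f))))) (BR * r))))
  (h7 : ∀ F : T4Family, ∃ C ε₀ : ℝ, 0 ≤ C ∧ 0 < ε₀ ∧ ∀ ε : ℝ, 0 < ε → ε ≤ ε₀ →
      LeafH3sup 4 F.L (ne3NperOfRecord₁₁ F 0 0) ε (C * ε) (C * ε) (ne3DomOfRecord₁₁ F N 0 0))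

include hβ0 hβ1 hg₃ hD h7

variable (w1 : (F : T4Family) → (θ : Stage13HParams F N) → Node00.W1.ReadingData F (Node00.MatA N) θ.τ9.M)
  (ne2 : (F : T4Family) → Stage13HParams F N → (ℕ → ℝ) → List (ULoop F) → ℕ → NE2Objects₁₁)
  (ne1 : (F : T4Family) → Stage13HParams F N → (ℕ → ℝ) → List (ULoop F) → NE1pCarriers)

/-- ★★ **N27 = B5 AT THE REGIME RECORD CLASS FROM THE SLOTS AT THE REGIME HOME OF THE READING OF RECORD, THE N16 SLOT IN THE CURRENCY OF RECORD R-β READ OFF NODE N06's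
THEOREM 3.3 + DICTIONARY (Hölder binder at exponent `β`) + LETTERS + N07's LINEAR LEAF, LETTERS PRODUCED** ((L) `spine_rec13CCoPHOn_at_readingOfRecord₁₃CoPH_of_thm33Letters_allTorus`'s
β-twin: `h16` ⟸ 40ᴮ `exists_letters_s_N16Holder_readingOfRecord₁₃CoPHOn_of_thm33Letters_allTorus hβ0 hβ1 …`, the other rate slots in guarded θ-form (dag-n22-e `s_N1x_rRec₁₃CoPHOn_iff`), the
N19′ edge reading `RatesHolderAt … β` for every `ℓ₃`); at `Rg :=` the item's guard, `N = 2` THE ITEM is leaf E.  Every hypothesis 0∕1 today; NE3 at exponent β NOT PROVED. [bookkeeping] -/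
theorem spine_rec13CCoPHOn_at_readingOfRecord₁₃CoPH_holder_of_thm33Letters (Rg : (F : T4Family) → Stage13HParams F N → Prop)
    (h14 : ∀ (F : T4Family) (θ : Stage13HParams F N), θ.Provisos₁₃CoPH F N → Rg F θ → θ.Admissible F N → ∀ (g₀ : ℕ → ℝ) (os : List (ULoop F)),
      N14At (ne1 F θ g₀ os))
    (h15 : ∀ (F : T4Family) (θ : Stage13HParams F N), θ.Provisos₁₃CoPH F N → Rg F θ → θ.Admissible F N → ∀ (g₀ : ℕ → ℝ) (os : List (ULoop F)) (k : ℕ),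
      N15At (ne2OfRecord₁₁ (ne2 F θ g₀ os k)))
    (h18 : ∀ (F : T4Family) (θ : Stage13HParams F N), θ.Provisos₁₃CoPH F N → Rg F θ → θ.Admissible F N → ∀ k : ℕ,
      N18At (u3OfRecord₁₃ θ.toStage13Params ((w1 F θ).u3Objects θ.γ) k))
    (h22 : ∀ (F : T4Family) (θ : Stage13HParams F N), θ.Provisos₁₃CoPH F N → Rg F θ → θ.Admissible F N → ∀ k : ℕ,
      N22At (u3OfRecord₁₃ θ.toStage13Params ((w1 F θ).u3Objects θ.γ) k))
    (hD4 : ∀ (F : T4Family) (θ : Stage13HParams F N) (hP : θ.Provisos₁₃CoPH F N), Rg F θ → θ.Admissible F N → ∀ k : ℕ,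
      ReadOutAt (datumOfRecord₁₃CoPH F N θ hP) (u3OfRecord₁₃ θ.toStage13Params ((w1 F θ).u3Objects θ.γ) k))
    (h20 : S_N20 (SRec₁₃CoPHOn cr Rg)) (h21 : S_N21 (SRec₁₃CoPHOn cr Rg))
    (hx : ∀ (F : T4Family) (θ : Stage13HParams F N) (hP : θ.Provisos₁₃CoPH F N), Rg F θ → θ.Admissible F N →
      B16.EndStatementBPrinted (datumOfRecord₁₃CoPH F N θ hP).C → DagBinding.EndpointExistence (datumOfRecord₁₃CoPH F N θ hP).C.toB12 →
        ForSmallCouplings (datumOfRecord₁₃CoPH F N θ hP) fun g₀ => ∀ os : List (ULoop F),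
          0 < (cr F θ hP g₀ os).l₀ ∧ 0 < (cr F θ hP g₀ os).vol ∧
          (∀ (K : ℕ) (t : ℝ), |t| ≤ (cr F θ hP g₀ os).l₀ →
            T4GenFunBounds.schemeZ ((datumOfRecord₁₃CoPH F N θ hP).scheme g₀) os ((cr F θ hP g₀ os).K₀ + K) t =
              ∑ τ ∈ (cr F θ hP g₀ os).T K, (cr F θ hP g₀ os).A K t τ) ∧
          (∀ (K : ℕ) (t : ℝ), |t| ≤ (cr F θ hP g₀ os).l₀ →
            T4GenFunBounds.schemeZ ((datumOfRecord₁₃CoPH F N θ hP).scheme g₀) os ((cr F θ hP g₀ os).K₀ + K + 1) t =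
              ∑ τ ∈ (cr F θ hP g₀ os).T K, (cr F θ hP g₀ os).B K t τ))
    (h19 : ∀ (ℓ₃ : T4Family → NE3Letters₁₁) (F : T4Family) (θ : Stage13HParams F N) (hP : θ.Provisos₁₃CoPH F N), Rg F θ → θ.Admissible F N → ∀ (g₀ : ℕ → ℝ) (os : List (ULoop F)),
      (∀ k : ℕ, RatesHolderAt (datumOfRecord₁₃CoPH F N θ hP) (rateCarriersOfRecord₁₃CoPH (readingOfRecord₁₃CoPH w1 ℓ₃ ne2 ne1) F θ hP g₀ os k) β) → letI := (cr F θ hP g₀ os).dec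
        ∃ δ : ℕ → ℝ, NE7.Core (cr F θ hP g₀ os).l₀ (cr F θ hP g₀ os).vol (cr F θ hP g₀ os).T (cr F θ hP g₀ os).Bad
          (fun K t τ => (cr F θ hP g₀ os).A K t τ - (cr F θ hP g₀ os).shA K t τ) (fun K t τ => (cr F θ hP g₀ os).B K t τ - (cr F θ hP g₀ os).shB K t τ) δ ∧
          Summable δ) :
    Spine (N := N) fun F D w => Node00.IsRecordOfRecord₁₃CCoPHOn F N Rg D w := by
  obtain ⟨ℓ₃, h16, -⟩ :=
    exists_letters_s_N16Holder_readingOfRecord₁₃CoPHOn_of_thm33Letters_allTorus hβ0 hβ1 (Rg := Rg) (w1 := w1) (ne2 := ne2) (ne1 := ne1) hg₃ hD h7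
  exact spine_rec13CCoPHOn_at_readingOfRecord₁₃CoPH_holder cr β w1 ne2 ne1 Rg ℓ₃
    ((s_N14_rRec₁₃CoPHOn_iff _ Rg).mpr fun F θ hP hRg hθ g₀ os => h14 F θ hP hRg hθ g₀ os)
    ((s_N15_rRec₁₃CoPHOn_iff _ Rg).mpr fun F θ hP hRg hθ g₀ os k => h15 F θ hP hRg hθ g₀ os k) h16
    ((s_N18_rRec₁₃CoPHOn_iff _ Rg).mpr fun F θ hP hRg hθ _ _ k => h18 F θ hP hRg hθ k)
    ((s_N22_rRec₁₃CoPHOn_iff _ Rg).mpr fun F θ hP hRg hθ _ _ k => h22 F θ hP hRg hθ k)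
    ((s_D4_rRec₁₃CoPHOn_iff _ Rg).mpr fun F θ hP hRg hθ _ _ k => hD4 F θ hP hRg hθ k) h20 h21 hx (h19 ℓ₃)

end Thm33

end Summit.QuantumFields.YangMills.Theorems.BalabanUVNodesN27SpineRecord
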